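import Summits.RiemannHypothesis.RiemannHypothesis.Theorems.NymanBeurlingKernelCertificate
import HarnessLib

/-!
# RiemannHypothesis / Nyman–Beurling — KERNEL LINEAGE K, part 3: soundness of the row certificates

Column LI/NB, rung L-D (b) → L-P(P2), PROOF-OF-DATA for cell `pub/rh-li` [rh-li-eng-3].  Continuation of
`NymanBeurlingKernelCertificate.lean`: the interval sums `byEncl ∋ b·y_N`, `gyEncl ∋ (G y_N)_k`, `ygyEncl ∋ y_N·G y_N` and the
residual bound `resSq` are sound (`mem_byEncl`, …, `resid_le_of_resSq`); with the form bound `λ‖v‖² ≤ v·G_M v` of part 2 the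
tree's certificate logic `nbDistSq_certificate_of_tier` turns a passing `rowCheck N` into the three claims
(`rowCheck_sound`), and `certCheck_sound` assembles everything: if `certCheck prm c = true` then for every `1 ≤ N ≤ M`,
`dlo_N/S ≤ d_N² ≤ dhi_N/S` and `|ỹ_{N,k} − c⋆_{N,k}| ≤ rad_N/S` for all `k < N`.

RH-FREE: finite-dimensional linear algebra and interval arithmetic; nothing here bears on `d_N → 0` or on the truth of RH.
-/

-- D-0017: `Summit.<S>.<S>.…` is the designed namespace of a single-problem summit.
set_option linter.dupNamespace false

namespace Summit.RiemannHypothesis.RiemannHypothesis.Theorems.NbTheory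

open Literature.NumberTheory.LFunctions
open Literature.Analysis.ValidatedNumerics Literature.Analysis.ValidatedNumerics.NumericsMP
open Finset
open scoped Matrix

namespace NbKernel

section Sound

variable {prm : Params} {c : Cert} {G : List (List (Option MI))} {B : List (Option MI)}

/-! ## Soundness of the row certificates -/

/-- Soundness of `osum`: it encloses the corresponding `Finset.range` sum. -/
theorem mem_osum {S : ℕ} {f : ℕ → Option MI} {g : ℕ → ℝ} :
    ∀ (n : ℕ) (A : MI), (∀ k, k < n → ∀ t, f k = some t → MI.mem S (g k) t) → osum f n = some A →
      MI.mem S (∑ k ∈ Finset.range n, g k) A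
  | 0, A, _, h => by
    simp only [osum, Option.some.injEq] at h
    subst h; simp [MI.mem]
  | n + 1, A, hf, h => by
    simp only [osum] at h
    split at h
    · rename_i a t ha ht
      simp only [Option.some.injEq] at h; subst h
      rw [Finset.sum_range_succ]
      exact MI.mem_add (mem_osum n a (fun k hk t' ht' ↦ hf k (by omega) t' ht') ha) (hf n (by omega) t ht)
    · simp at h

/-- Soundness of `omulInt`. -/
theorem mem_omulInt {S : ℕ} {o : Option MI} {x : ℝ} (ho : ∀ t, o = some t → MI.mem S x t) (z : ℤ) {Y : MI}
    (h : omulInt o z = some Y) : MI.mem S (x * z) Y := by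
  cases o with
  | none => simp [omulInt] at h
  | some g =>
    simp only [omulInt, Option.some.injEq] at h
    subst h
    exact MI.mem_mulInt (ho g rfl) z

/-- `(G y_N)_k ∈ gyEncl`. -/
theorem mem_gyEncl (hG : GramOK prm c G) {N k : ℕ} (hN : N ≤ c.M) (hk : k < c.M) {Y : MI}
    (h : gyEncl c G N k = some Y) :
    MI.mem prm.S (∑ j ∈ Finset.range N, nbGram k j * (yget c N j : ℝ)) Y :=
  mem_osum N Y (fun j hj t ht ↦ mem_omulInt (fun t' ht' ↦ hG k j hk (by omega) t' ht') _ ht) h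

/-- `b·y_N ∈ byEncl`. -/
theorem mem_byEncl (hB : RhsOK prm c B) {N : ℕ} (hN : N ≤ c.M) {Y : MI} (h : byEncl c B N = some Y) :
    MI.mem prm.S (∑ k ∈ Finset.range N, nbRhs k * (yget c N k : ℝ)) Y :=
  mem_osum N Y (fun k hk t ht ↦ mem_omulInt (fun t' ht' ↦ hB k (by omega) t' ht') _ ht) h

/-- `y_N·G y_N ∈ ygyEncl`. -/
theorem mem_ygyEncl (hG : GramOK prm c G) {N : ℕ} (hN : N ≤ c.M) {Y : MI} (h : ygyEncl c G N = some Y) :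
    MI.mem prm.S (∑ k ∈ Finset.range N, (∑ j ∈ Finset.range N, nbGram k j * (yget c N j : ℝ)) * (yget c N k : ℝ)) Y :=
  mem_osum N Y (fun k hk t ht ↦ mem_omulInt (fun t' ht' ↦ mem_gyEncl hG hN (by omega) ht') _ ht) h

/-- `resSq N n = some R` ⇒ `Σ_{k<n} r_k² ≤ R/S²`, `r_k = b_k − Σ_j G_{kj} ỹ_j`. -/
theorem resid_le_of_resSq (hG : GramOK prm c G) (hB : RhsOK prm c B) (hS : 0 < prm.S) {N : ℕ} (hN : N ≤ c.M) :
    ∀ (n : ℕ) (R : ℤ), n ≤ c.M → resSq prm c G B N n = some R →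
      (∑ k ∈ Finset.range n, (nbRhs k - ∑ j ∈ Finset.range N, nbGram k j * ((yget c N j : ℝ) / 2 ^ c.TB)) ^ 2)
        ≤ (R : ℝ) / ((prm.S : ℝ) ^ 2)
  | 0, R, _, h => by
    simp only [resSq, Option.some.injEq] at h
    subst h; simp
  | n + 1, R, hn, h => by
    simp only [resSq] at h
    split at h
    · rename_i s b t hs hb ht
      simp only [Option.some.injEq] at h; subst h
      have ih := resid_le_of_resSq hG hB hS hN n s (by omega) hs
      have hSr : (0 : ℝ) < prm.S := by exact_mod_cast hS
      have mb := hB n (by omega) b hb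
      have mt := mem_gyEncl hG hN (by omega) ht
      have mr := MI.mem_sub mb (MI.mem_divNat mt (n := 2 ^ c.TB) (by positivity))
      have hab := MI.abs_le_absHi mr
      have e : ∑ j ∈ Finset.range N, nbGram n j * ((yget c N j : ℝ) / 2 ^ c.TB) =
          (∑ j ∈ Finset.range N, nbGram n j * (yget c N j : ℝ)) / ((2 ^ c.TB : ℕ) : ℝ) := by
        rw [Finset.sum_div]; push_cast
        exact Finset.sum_congr rfl fun j _ ↦ by ring
      rw [Finset.sum_range_succ, e]
      set r := nbRhs n - (∑ j ∈ Finset.range N, nbGram n j * (yget c N j : ℝ)) / ((2 ^ c.TB : ℕ) : ℝ)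
      have hr2 : r ^ 2 ≤ (((b.sub (t.divNat (2 ^ c.TB))).absHi : ℤ) : ℝ) ^ 2 / (prm.S : ℝ) ^ 2 := by
        rw [le_div_iff₀ (by positivity), ← mul_pow]
        have h0 : 0 ≤ |r| * prm.S := by positivity
        calc (r * prm.S) ^ 2 = (|r| * prm.S) ^ 2 := by rw [mul_pow, mul_pow, sq_abs]
          _ ≤ _ := pow_le_pow_left₀ h0 hab 2
      push_cast
      rw [add_div]
      exact add_le_add ih hr2
    · simp at h

/-- **Soundness of one row (RH-FREE)**: a passing `rowCheck N` with a form bound `λ` at tier `M ≥ N` proves the three claims. -/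
theorem rowCheck_sound (hG : GramOK prm c G) (hB : RhsOK prm c B) (hS : 0 < prm.S) (hlam : 0 < c.lamN)
    (hform : ∀ v : Fin c.M → ℝ, ((c.lamN : ℝ) / 2 ^ c.LP) * ∑ i, v i ^ 2 ≤ v ⬝ᵥ (nbGramMatrix c.M *ᵥ v))
    {N : ℕ} (hN : N ≤ c.M) (h : rowCheck prm c G B N = true) :
    ((vget c.dlo (N - 1) : ℤ) : ℝ) / prm.S ≤ nbDistSq N (nbMinimiser N) ∧
      nbDistSq N (nbMinimiser N) ≤ ((vget c.dhi (N - 1) : ℤ) : ℝ) / prm.S ∧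
      ∀ k : Fin N, |trial c N k - nbMinimiser N k| ≤ ((vget c.rad (N - 1) : ℕ) : ℝ) / prm.S := by
  have hSr : (0 : ℝ) < prm.S := by exact_mod_cast hS
  set lam : ℝ := (c.lamN : ℝ) / 2 ^ c.LP with hlamdef
  have hlam' : 0 < lam := by positivity
  unfold rowCheck at h
  split at h
  · rename_i l qd R hl hqd hR
    simp only [Bool.and_eq_true, decide_eq_true_eq] at h
    obtain ⟨⟨h1, h2⟩, h3⟩ := h
    -- the certificate logic of the tree
    obtain ⟨c1, c2, c3⟩ := nbDistSq_certificate_of_tier hN hlam' hform (trial c N)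
    -- the residual
    have hres : (∑ k : Fin N, (nbRhs k - ∑ j : Fin N, nbGram k j * trial c N j) ^ 2) ≤ (R : ℝ) / (prm.S : ℝ) ^ 2 := by
      have := resid_le_of_resSq hG hB hS hN N R hN hR
      rw [Finset.sum_range (fun k ↦ (nbRhs k -
        ∑ j ∈ Finset.range N, nbGram k j * ((yget c N j : ℝ) / 2 ^ c.TB)) ^ 2)] at this
      convert this using 3 with k _
      rw [Finset.sum_range (fun j ↦ nbGram k j * ((yget c N j : ℝ) / 2 ^ c.TB))]
      rfl
    -- the quadratic form at the trial vector
    have hQ : MI.mem prm.S (nbDistSq N (trial c N)) (qEncl prm c l qd) := by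
      have ml := mem_byEncl hB hN hl
      have mq := mem_ygyEncl hG hN hqd
      have m := MI.mem_add (MI.mem_sub (MI.mem_ofInt prm.S 1) (MI.mem_divNat (MI.mem_mulInt ml 2)
        (n := 2 ^ c.TB) (by positivity))) (MI.mem_divNat mq (n := 2 ^ (2 * c.TB)) (by positivity))
      have eL : ∑ k : Fin N, trial c N k * nbRhs k = (∑ k ∈ Finset.range N, nbRhs k * (yget c N k : ℝ)) / 2 ^ c.TB := by
        rw [Finset.sum_range (fun k ↦ nbRhs k * (yget c N k : ℝ)), Finset.sum_div]
        exact Finset.sum_congr rfl fun k _ ↦ by simp only [trial]; ring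
      have eQ : trial c N ⬝ᵥ (nbGramMatrix N *ᵥ trial c N) =
          (∑ k ∈ Finset.range N, (∑ j ∈ Finset.range N, nbGram k j * (yget c N j : ℝ)) * (yget c N k : ℝ)) / 2 ^ (2 * c.TB) := by
        rw [Finset.sum_range (fun k ↦ (∑ j ∈ Finset.range N, nbGram k j * (yget c N j : ℝ)) * (yget c N k : ℝ)), Finset.sum_div]
        simp only [dotProduct, Matrix.mulVec, nbGramMatrix, Matrix.of_apply]
        refine Finset.sum_congr rfl fun k _ ↦ ?_
        rw [Finset.sum_range (fun j ↦ nbGram k j * (yget c N j : ℝ)), Finset.mul_sum, Finset.sum_mul, Finset.sum_div]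
        refine Finset.sum_congr rfl fun j _ ↦ ?_
        simp only [trial]
        rw [pow_mul']
        ring
      have e : nbDistSq N (trial c N) = ((1 : ℤ) : ℝ) -
          (∑ k ∈ Finset.range N, nbRhs k * (yget c N k : ℝ)) * ((2 : ℤ) : ℝ) / ((2 ^ c.TB : ℕ) : ℝ) +
          (∑ k ∈ Finset.range N, (∑ j ∈ Finset.range N, nbGram k j * (yget c N j : ℝ)) * (yget c N k : ℝ)) /
            ((2 ^ (2 * c.TB) : ℕ) : ℝ) := by
        rw [Minimiser.nbDistSq_eq_quadratic, eL, eQ]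
        push_cast
        ring
      rw [e]; exact m
    have hQlo := MI.lo_div_le hS hQ
    have hQhi := MI.le_hi_div hS hQ
    refine ⟨?_, ?_, ?_⟩
    · -- lower claim
      have h2r : (R : ℝ) * 2 ^ c.LP ≤ (((qEncl prm c l qd).lo : ℝ) - ((vget c.dlo (N - 1) : ℤ) : ℝ)) * prm.S * c.lamN := by
        exact_mod_cast h2
      have hlamN : (0 : ℝ) < c.lamN := by exact_mod_cast hlam
      have key : (R : ℝ) / (prm.S : ℝ) ^ 2 / lam ≤ ((qEncl prm c l qd).lo : ℝ) / prm.S - ((vget c.dlo (N - 1) : ℤ) : ℝ) / prm.S := by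
        rw [hlamdef, div_div, div_le_iff₀ (by positivity)]
        have : (((qEncl prm c l qd).lo : ℝ) / prm.S - ((vget c.dlo (N - 1) : ℤ) : ℝ) / prm.S) * ((prm.S : ℝ) ^ 2 * (c.lamN / 2 ^ c.LP))
            = ((((qEncl prm c l qd).lo : ℝ) - ((vget c.dlo (N - 1) : ℤ) : ℝ)) * prm.S * c.lamN) / 2 ^ c.LP := by
          field_simp
        rw [this, le_div_iff₀ (by positivity)]
        exact h2r
      have : nbDistSq N (trial c N) - nbDistSq N (nbMinimiser N) ≤ (R : ℝ) / (prm.S : ℝ) ^ 2 / lam :=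
        le_trans c2 (div_le_div_of_nonneg_right hres hlam'.le)
      linarith
    · -- upper claim
      have h1r : ((qEncl prm c l qd).hi : ℝ) ≤ ((vget c.dhi (N - 1) : ℤ) : ℝ) := by exact_mod_cast h1
      have : ((qEncl prm c l qd).hi : ℝ) / prm.S ≤ ((vget c.dhi (N - 1) : ℤ) : ℝ) / prm.S :=
        div_le_div_of_nonneg_right h1r hSr.le
      linarith
    · -- coefficient claim
      intro k
      have h3r : (R : ℝ) * 2 ^ (2 * c.LP) ≤ ((vget c.rad (N - 1) : ℕ) : ℝ) ^ 2 * (c.lamN : ℝ) ^ 2 := by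
        exact_mod_cast h3
      have hsum : ∑ j : Fin N, (trial c N j - nbMinimiser N j) ^ 2 ≤ (R : ℝ) / (prm.S : ℝ) ^ 2 / lam ^ 2 :=
        le_trans c3 (div_le_div_of_nonneg_right hres (by positivity))
      have hk : (trial c N k - nbMinimiser N k) ^ 2 ≤ ∑ j : Fin N, (trial c N j - nbMinimiser N j) ^ 2 :=
        Finset.single_le_sum (f := fun j ↦ (trial c N j - nbMinimiser N j) ^ 2) (fun j _ ↦ sq_nonneg _)
          (Finset.mem_univ k)
      have hbound : (R : ℝ) / (prm.S : ℝ) ^ 2 / lam ^ 2 ≤ ((((vget c.rad (N - 1) : ℕ) : ℝ)) / prm.S) ^ 2 := by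
        rw [hlamdef, div_pow, div_pow, div_div, div_le_div_iff₀ (by positivity) (by positivity)]
        have : (R : ℝ) * (prm.S : ℝ) ^ 2 = (R : ℝ) * 2 ^ (2 * c.LP) * ((prm.S : ℝ) ^ 2 / (2 ^ c.LP) ^ 2) := by
          rw [pow_mul']; field_simp
        rw [this]
        calc (R : ℝ) * 2 ^ (2 * c.LP) * ((prm.S : ℝ) ^ 2 / (2 ^ c.LP) ^ 2)
            ≤ ((vget c.rad (N - 1) : ℕ) : ℝ) ^ 2 * (c.lamN : ℝ) ^ 2 * ((prm.S : ℝ) ^ 2 / (2 ^ c.LP) ^ 2) := by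
              gcongr
          _ = ((vget c.rad (N - 1) : ℕ) : ℝ) ^ 2 * ((prm.S : ℝ) ^ 2 * ((c.lamN : ℝ) ^ 2 / (2 ^ c.LP) ^ 2)) := by ring
      exact abs_le_of_sq_le_sq (by linarith) (by positivity)
  · simp at h

end Sound

/-! ## Soundness of the whole certificate -/

/-- **Soundness of the kernel certificate (RH-FREE).**  If `certCheck prm c` evaluates to `true`, then for every
`1 ≤ N ≤ M`: `dlo_N/S ≤ d_N² ≤ dhi_N/S` and every coefficient of the Báez-Duarte minimiser `c⋆_N` lies within `rad_N/S`
of the certificate's trial vector `ỹ_N = y_N/2^TB`. -/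
theorem certCheck_sound {prm : Params} {c : Cert} (h : certCheck prm c = true) {N : ℕ} (hN1 : 1 ≤ N)
    (hN : N ≤ c.M) :
    ((vget c.dlo (N - 1) : ℤ) : ℝ) / prm.S ≤ nbDistSq N (nbMinimiser N) ∧
      nbDistSq N (nbMinimiser N) ≤ ((vget c.dhi (N - 1) : ℤ) : ℝ) / prm.S ∧
      ∀ k : Fin N, |trial c N k - nbMinimiser N k| ≤ ((vget c.rad (N - 1) : ℕ) : ℝ) / prm.S := by
  unfold certCheck at h
  split at h
  · rename_i piI hpi
    split at h
    · rename_i c0 hc0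
      simp only [Bool.and_eq_true, decide_eq_true_eq] at h
      obtain ⟨⟨⟨hS, hlam⟩, hger⟩, hrows⟩ := h
      have mpi := MI.mem_pi prm.S hpi
      have mc0 := mem_l2pigEncl hS mpi hc0
      have hGt : GramOK prm c (gramTable prm.S c.M (cotTable prm.S prm.KEXP prm.KSQ c.M piI)
          (logTable prm.S prm.KLOG c.M) c0 piI) :=
        fun j k hj hk Y hY ↦ mem_gget_gramTable hS mpi mc0 hj hk hY
      have hBt : RhsOK prm c (rhsTable prm.S c.M (logTable prm.S prm.KLOG c.M)) :=
        fun k hk Y hY ↦ mem_lget_rhsTable hS hk hY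
      have hform := form_bound_of_gershCheck hS hGt hger
      have hrow := of_rall hrows (k := N - 1) (by omega)
      rw [Nat.sub_add_cancel hN1] at hrow
      exact rowCheck_sound hGt hBt hS hlam hform hN hrow
    · simp at h
  · simp at h

end NbKernel

end Summit.RiemannHypothesis.RiemannHypothesis.Theorems.NbTheory
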